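import Summits.MatrixMultiplication.MatrixMultiplication.Theorems.SaturationLadderLittleCwRect
import Literature.Computability.AlgebraicComplexity.RectangularExponentAlpha
import HarnessLib

/-!
# Route `SaturationLadder` — the THIN SWEET-SPOT SEGMENT of the little CW tensor (decomp-mm lens 1
«grading / quantitative ladder», gen 24; chain file 2/2, support helper beneath crux `SubexpSaturation`)

Grading the route's thin currency — exact tight points `ω(1, t, r) = 1 + r`, `t ≤ 1 ≤ r` (crux `SubexpSaturation`,
stmt-MatrixMultiplication-25909) — by the ASYMPTOTIC-RANK DEFICIENCY `η_q := R̃(cw_q) − (q+1)` of the little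
Coppersmith–Winograd tensor.  From the general-shape bound of chain file 1
(`SaturationLadderLittleCwRect.littleCwRectBound`) at the type `(B, A, C)`, `A + C = qB`, `B = min`:

* `omegaRect_segment_le` — `R̃(cw_q) ≤ r ⟹ ω(A, B, C) ≤ (q+1)B (log r − h(1/(q+1)))/log q` on the whole SEGMENT
  `{(A, B, C) : B ≤ A, B ≤ C, A + C = qB}`; since `(q+1) h(1/(q+1)) = (q+1) log(q+1) − q log q` (`binEntropy_base`)
  the value at `r = q + 1 + η` is `qB + (q+1)B·log(1 + η/(q+1))/log q ≤ qB + Bη/log q` (`omegaRect_segment_le_add`):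
  the **η-GRADED THIN DEFECT** `ω(A,B,C) − (A + C) ≤ B·η_q/log q`;
* `omegaRect_segment_eq_of_flat` — **`Flat(cw_q)` (`η_q = 0`) makes the ENTIRE segment exactly tight**:
  `ω(A, B, qB − A) = qB = A + C`.  Normalised (`omegaRect_thin_eq_of_flat`, all REAL `t` by monotonicity + density):
  `R̃(cw_q) ≤ q + 1 ⟹ ω(1, t, qt − 1) = qt` for every `t ∈ [1/(q−1), 1]`.
  The segment runs from lens 2's far sweet spot `(1, 1, q−1)` (`t = 1`: `E_{q−1}`,
  `Theorems.FarEdgeDescentLittleCwTransfer.finiteSaturation_of_littleCwMinimal` — cited, not restated) through the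
  **α-POINT** `(q, 2, q)` (`t = 2/q`: `ω(1, 2/q, 1) = 2`) to the mirror far point `(q−1, 1, 1)`; so
  `alpha_ge_of_littleCwFlat`: **`Flat(cw_q) ⟹ α ≥ 2/q`**, with the η-graded form
  `omegaRect_alphaPoint_le`: `R̃(cw_q) ≤ q+1+η ⟹ ω(1, 2/q, 1) ≤ 2 + 2η/(q log q)`.  At `q = 2` the α-point is
  `(1,1,1)` and the corollary is Coppersmith–Winograd's `R̃(cw₂) = 3 ⟹ ω = 2` (already in the tree as
  `CwPrimeTensorIsoCwTwo.omega_eq_two_of_asymptoticRank_cwTensor_two_le`, not restated); at `q = 3`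
  (`flat₃_thin`): `R̃(cw₃) = 4 ⟹ ω(1,2,1) = 3 ∧ α ≥ 2/3 ∧ ω(1, t, 3t−1) = 3t (t ∈ [1/2, 1])`.
* LADDER READING (lens 1).  In the length function `r(t) := min {r : ω(1,t,r) = 1+r}` of the route
  (`ExpSaturation ⟸ SubexpSaturation ⟸ PolySaturation ⟸ FiniteSaturation ⟸ S`), `Flat(cw_q)` at ONE `q ≥ 3`
  gives `r(t) ≤ qt − 1 ≤ q − 1` on `[2/q, 1)` — bounded length, hence every rung — and the first-power little-CW method
  certifies EXACT thin tightness ONLY at `η_q = 0`: maximising the bound over real `q` at fixed `η` leaves the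
  defect `t·log(1+η_q)/log q > 0` (docstring of `omegaRect_segment_le_add`).  Quantitatively the thin defect along the
  segment is LINEAR in `η_q` with slope `B/log q`, the far excess (`B = A`, lens 2's `excess_le_of_littleCwDeficiency`)
  being the `t = 1` end of the same formula.
Support module beneath stmt-MatrixMultiplication-25909 (`--supports`); closes no item; imports only BUILT modules
(chain file 1, `RectangularExponentAlpha`; no module in the `Theses` cone — the two-slot monotonicity
`omegaRect_one_mono₂₃` used by the density step is the `a = a' = 1` case of the lineage's `omegaRect_mono'`,
proved here from `tensorRank_matMulTensor_mono₃` so as not to import `SaturationLadderExpSaturation`).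
[cite: CoppersmithWinograd1990, §6; BurgisserClausenShokrollahi1997, Thm. 15.41; VassilevskaWilliamsXuXuZhou2024, §1]
-/

set_option linter.dupNamespace false

noncomputable section

namespace Summit.MatrixMultiplication.MatrixMultiplication.Theorems.SaturationLadderLittleCwThin

open Literature.Computability.AlgebraicComplexity
open Summit.MatrixMultiplication.MatrixMultiplication.Theorems.SaturationLadderLittleCwRect (littleCwRectBound)
open Summit.MatrixMultiplication.MatrixMultiplication.Theorems.LittleCwFarEdgeBound (binEntropy_far)
open Filter Asymptotics

/-! ## The segment bound and its η-graded defect -/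

/-- The entropy identity at the little-CW base point: `(q+1)·h(1/(q+1)) = (q+1) log(q+1) − q log q`
(lens 2's `binEntropy_far` at `K = q − 1`). -/
theorem binEntropy_base (q : ℝ) (hq : 1 ≤ q) :
    (q + 1) * Real.binEntropy (1 / (q + 1)) = (q + 1) * Real.log (q + 1) - q * Real.log q := by
  have h := binEntropy_far (q - 1) (by linarith)
  have e1 : q - 1 + 2 = q + 1 := by ring
  have e2 : q - 1 + 1 = q := by ring
  rw [e1, e2] at h
  exact h

/-- **Segment bound.**  For `q ≥ 2`, `1 ≤ B ≤ A`, `B ≤ C`, `A + C = qB` and `R̃(cw_q) ≤ r`: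
`ω(A, B, C) ≤ (q+1) B (log r − h(1/(q+1))) / log q` (chain file 1 at the type `(B, A, C)`: total `(q+1)B`,
least mass `B/((q+1)B) = 1/(q+1)`; then `ω(B,A,C) = ω(A,B,C)`). -/
theorem omegaRect_segment_le {q A B C : ℕ} (hq : 2 ≤ q) (hB : 1 ≤ B) (hBA : B ≤ A) (hBC : B ≤ C)
    (hsum : A + C = q * B) {r : ℝ} (hr : asymptoticRank (cwTensor ℂ q) ≤ r) :
    omegaRect ℂ A B C ≤
      ((q : ℝ) + 1) * B * (Real.log r - Real.binEntropy (1 / ((q : ℝ) + 1))) / Real.log (q : ℝ) := by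
  have h := littleCwRectBound q B A C hq hB hBA hBC r hr
  rw [omegaRect_swap₁₂ ℂ (B : ℝ) A C] at h
  have hB0 : (0 : ℝ) < B := by exact_mod_cast (by omega : 0 < B)
  have hq0 : (0 : ℝ) < (q : ℝ) + 1 := by positivity
  have hS : (B : ℝ) + A + C = ((q : ℝ) + 1) * B := by
    have e : (((A + C : ℕ) : ℝ)) = (((q * B : ℕ) : ℝ)) := by rw [hsum]
    push_cast at e
    linarith
  have hfrac : (B : ℝ) / (((q : ℝ) + 1) * B) = 1 / ((q : ℝ) + 1) := by
    field_simp
  rw [hS, hfrac] at h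
  exact h

/-- **η-graded thin defect.**  `R̃(cw_q) ≤ q + 1 + η` (`η ≥ 0`) gives, on the segment,
`ω(A, B, C) ≤ qB + Bη/log q = (A + C) + B·η/log q`.  (With `log(q+1+η) ≤ log(q+1) + η/(q+1)` and
`binEntropy_base`.  Remark: optimising the first-power bound `S·(log(q+1+η) − h(t/S))/log q` over a REAL base
`q` at fixed `η > 0` still leaves the defect `t·log(1+η)/log q > 0` above `1 + r`, so EXACT thin tightness from
the first power of `cw_q` needs `η = 0` exactly — the grading by `η` is linear with slope `B/log q`.) -/
theorem omegaRect_segment_le_add {q A B C : ℕ} (hq : 2 ≤ q) (hB : 1 ≤ B) (hBA : B ≤ A) (hBC : B ≤ C)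
    (hsum : A + C = q * B) {η : ℝ} (hη : 0 ≤ η)
    (hr : asymptoticRank (cwTensor ℂ q) ≤ (q : ℝ) + 1 + η) :
    omegaRect ℂ A B C ≤ (q : ℝ) * B + (B : ℝ) * η / Real.log (q : ℝ) := by
  have h := omegaRect_segment_le hq hB hBA hBC hsum hr
  have hq2 : (2 : ℝ) ≤ q := by exact_mod_cast hq
  have hq1 : (1 : ℝ) < q := by linarith
  have hlogq : 0 < Real.log (q : ℝ) := Real.log_pos hq1
  have hB0 : (0 : ℝ) ≤ B := Nat.cast_nonneg B
  have hid := binEntropy_base (q : ℝ) hq1.le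
  have hq10 : (0 : ℝ) < (q : ℝ) + 1 := by linarith
  have hlogle : Real.log ((q : ℝ) + 1 + η) ≤ Real.log ((q : ℝ) + 1) + η / ((q : ℝ) + 1) := by
    have hpos : 0 < ((q : ℝ) + 1 + η) / ((q : ℝ) + 1) := div_pos (by linarith) hq10
    have hl := Real.log_le_sub_one_of_pos hpos
    rw [Real.log_div (by linarith) hq10.ne', div_sub_one hq10.ne'] at hl
    have e : ((q : ℝ) + 1 + η - ((q : ℝ) + 1)) / ((q : ℝ) + 1) = η / ((q : ℝ) + 1) := by ring
    linarith
  have h3 : ((q : ℝ) + 1) * Real.log ((q : ℝ) + 1 + η) ≤ ((q : ℝ) + 1) * Real.log ((q : ℝ) + 1) + η := by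
    have h3' := mul_le_mul_of_nonneg_left hlogle hq10.le
    have e2 : ((q : ℝ) + 1) * (Real.log ((q : ℝ) + 1) + η / ((q : ℝ) + 1)) =
        ((q : ℝ) + 1) * Real.log ((q : ℝ) + 1) + η := by
      field_simp
    linarith
  have key : ((q : ℝ) + 1) * B * (Real.log ((q : ℝ) + 1 + η) - Real.binEntropy (1 / ((q : ℝ) + 1))) ≤
      (q : ℝ) * B * Real.log (q : ℝ) + (B : ℝ) * η := by
    have e : ((q : ℝ) + 1) * B * (Real.log ((q : ℝ) + 1 + η) - Real.binEntropy (1 / ((q : ℝ) + 1))) =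
        (B : ℝ) * (((q : ℝ) + 1) * Real.log ((q : ℝ) + 1 + η) -
          ((q : ℝ) + 1) * Real.binEntropy (1 / ((q : ℝ) + 1))) := by ring
    rw [e, hid]
    have h4 : ((q : ℝ) + 1) * Real.log ((q : ℝ) + 1 + η) -
        (((q : ℝ) + 1) * Real.log ((q : ℝ) + 1) - (q : ℝ) * Real.log (q : ℝ)) ≤
        (q : ℝ) * Real.log (q : ℝ) + η := by linarith
    calc (B : ℝ) * (((q : ℝ) + 1) * Real.log ((q : ℝ) + 1 + η) -
          (((q : ℝ) + 1) * Real.log ((q : ℝ) + 1) - (q : ℝ) * Real.log (q : ℝ)))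
        ≤ (B : ℝ) * ((q : ℝ) * Real.log (q : ℝ) + η) := mul_le_mul_of_nonneg_left h4 hB0
      _ = (q : ℝ) * B * Real.log (q : ℝ) + (B : ℝ) * η := by ring
  have h2 : omegaRect ℂ A B C ≤ ((q : ℝ) * B * Real.log (q : ℝ) + (B : ℝ) * η) / Real.log (q : ℝ) :=
    h.trans (div_le_div_of_nonneg_right key hlogq.le)
  rw [add_div, mul_div_cancel_right₀ _ hlogq.ne'] at h2
  exact h2

/-- **`Flat(cw_q)` makes the whole segment exactly tight**: `R̃(cw_q) ≤ q + 1`, `1 ≤ B ≤ A`, `B ≤ C`,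
`A + C = qB ⟹ ω(A, B, C) = qB` (`= A + C`, the `X ⊗ Z`-flattening bound `add_le_omegaRect₁₃`).  At `q = 2` the
segment is the single point `(1,1,1)` and this is Coppersmith–Winograd's `R̃(cw₂) = 3 ⟹ ω = 2`, in the tree as
`CwPrimeTensorIsoCwTwo.omega_eq_two_of_asymptoticRank_cwTensor_two_le`. [cite: CoppersmithWinograd1990, §6] -/
theorem omegaRect_segment_eq_of_flat {q A B C : ℕ} (hq : 2 ≤ q) (hB : 1 ≤ B) (hBA : B ≤ A) (hBC : B ≤ C)
    (hsum : A + C = q * B) (hflat : asymptoticRank (cwTensor ℂ q) ≤ (q : ℝ) + 1) :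
    omegaRect ℂ A B C = (q : ℝ) * B := by
  have hr : asymptoticRank (cwTensor ℂ q) ≤ (q : ℝ) + 1 + 0 := by rw [add_zero]; exact hflat
  have h := omegaRect_segment_le_add hq hB hBA hBC hsum le_rfl hr
  rw [mul_zero, zero_div, add_zero] at h
  have hlow := add_le_omegaRect₁₃ ℂ (A : ℝ) B C
  have hAC : (A : ℝ) + C = (q : ℝ) * B := by exact_mod_cast hsum
  linarith

/-! ## Normalised form: `ω(1, t, qt − 1) = qt` for all real `t ∈ [1/(q−1), 1]` -/

/-- Two-slot monotonicity at first exponent `1`: `b ≤ b'`, `c ≤ c' ⟹ ω(1,b,c) ≤ ω(1,b',c')` (padding,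
`tensorRank_matMulTensor_mono₃`; the `a = a' = 1` case of the lineage's three-slot `omegaRect_mono'` in
`SaturationLadderExpSaturation`, re-derived so that this helper stays outside the `Theses` import cone). [folklore] -/
theorem omegaRect_one_mono₂₃ {b b' c c' : ℝ} (hb : b ≤ b') (hc : c ≤ c') :
    omegaRect ℂ 1 b c ≤ omegaRect ℂ 1 b' c' := by
  have hsub : rectAdmissibleExponents ℂ 1 b' c' ⊆ rectAdmissibleExponents ℂ 1 b c := by
    intro β hβ
    refine IsBigO.trans ?_ hβ
    refine IsBigO.of_bound 1 ?_
    filter_upwards [eventually_ge_atTop 1] with n hn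
    rw [one_mul, Real.norm_of_nonneg (Nat.cast_nonneg _), Real.norm_of_nonneg (Nat.cast_nonneg _)]
    exact_mod_cast tensorRank_matMulTensor_mono₃ ℂ le_rfl (rectDim_mono hn hb) (rectDim_mono hn hc)
  exact csInf_le_csInf (rectAdmissibleExponents_bddBelow ℂ 1 b c)
    (rectAdmissibleExponents_nonempty ℂ 1 b' c') hsub

/-- **The thin sweet-spot segment, real form.**  `R̃(cw_q) ≤ q + 1`, `q ≥ 2`:
`ω(1, t, qt − 1) = qt = 1 + (qt − 1)` for every REAL `t` with `1/(q−1) ≤ t ≤ 1`.  (Lower bound: the flattening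
`1 + (qt−1) ≤ ω`.  Upper bound: for `n → ∞` the integer point `(n, ⌈tn⌉, q⌈tn⌉ − n)` lies on the segment, is
exactly tight, dominates `(1, t, qt−1)` after scaling by `n` (monotonicity `omegaRect_one_mono₂₃`, homogeneity
`omegaRect_smul`), and `q⌈tn⌉/n < qt + q/n`.) -/
theorem omegaRect_thin_eq_of_flat {q : ℕ} (hq : 2 ≤ q) (hflat : asymptoticRank (cwTensor ℂ q) ≤ (q : ℝ) + 1)
    {t : ℝ} (ht1 : 1 / ((q : ℝ) - 1) ≤ t) (ht2 : t ≤ 1) :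
    omegaRect ℂ 1 t ((q : ℝ) * t - 1) = (q : ℝ) * t := by
  have hq2 : (2 : ℝ) ≤ q := by exact_mod_cast hq
  have hq0 : (0 : ℝ) < q := by linarith
  have hqm1 : (0 : ℝ) < (q : ℝ) - 1 := by linarith
  have hqt : 1 ≤ ((q : ℝ) - 1) * t := by
    have := (div_le_iff₀ hqm1).1 ht1
    linarith
  have ht0 : 0 < t := by
    have : 0 < 1 / ((q : ℝ) - 1) := by positivity
    linarith
  have hlow := add_le_omegaRect₁₃ ℂ (1 : ℝ) t ((q : ℝ) * t - 1)
  refine le_antisymm ?_ (by linarith)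
  refine le_of_forall_pos_lt_add fun ε hε => ?_
  obtain ⟨n, hn⟩ := exists_nat_gt ((q : ℝ) / ε)
  have hqε : 0 < (q : ℝ) / ε := div_pos hq0 hε
  have hn0r : (0 : ℝ) < n := hqε.trans hn
  have hn0 : 0 < n := by exact_mod_cast hn0r
  have hn1 : 1 ≤ n := hn0
  -- the grid point `B = ⌈t n⌉`
  set B : ℕ := ⌈t * n⌉₊ with hBdef
  have htn0 : 0 < t * n := mul_pos ht0 hn0r
  have hBge : t * n ≤ (B : ℝ) := Nat.le_ceil _
  have hBlt : (B : ℝ) < t * n + 1 := Nat.ceil_lt_add_one htn0.le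
  have hB1 : 1 ≤ B := Nat.one_le_iff_ne_zero.2 (Nat.pos_iff_ne_zero.1 (Nat.ceil_pos.2 htn0))
  have hBA : B ≤ n := Nat.ceil_le.2 (by nlinarith)
  have hkey : (n : ℝ) + B ≤ (q : ℝ) * B := by
    -- `(q−1) B ≥ (q−1) t n ≥ n`
    have h1 : ((q : ℝ) - 1) * (t * n) ≤ ((q : ℝ) - 1) * B := mul_le_mul_of_nonneg_left hBge hqm1.le
    have h2 : (n : ℝ) ≤ ((q : ℝ) - 1) * (t * n) := by
      have := mul_le_mul_of_nonneg_right hqt hn0r.le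
      linarith
    linarith
  have hkeyN : n + B ≤ q * B := by exact_mod_cast hkey
  obtain ⟨C, hC⟩ : ∃ C : ℕ, n + C = q * B := ⟨q * B - n, by omega⟩
  have hBC : B ≤ C := by omega
  have hseg := omegaRect_segment_eq_of_flat hq hB1 hBA hBC hC hflat
  -- homogeneity: `ω(n, B, C) = n · ω(1, B/n, C/n)`
  have hCr : (C : ℝ) = (q : ℝ) * B - n := by
    have e : (((n + C : ℕ) : ℝ)) = (((q * B : ℕ) : ℝ)) := by rw [hC]
    push_cast at e
    linarith
  have hBn : (0 : ℝ) ≤ (B : ℝ) / n := by positivity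
  have hCn : (0 : ℝ) ≤ (C : ℝ) / n := by positivity
  have hhom := omegaRect_smul ℂ hn1 (zero_le_one) hBn hCn
  have e1 : (n : ℝ) * 1 = n := mul_one _
  have e2 : (n : ℝ) * ((B : ℝ) / n) = B := mul_div_cancel₀ _ hn0r.ne'
  have e3 : (n : ℝ) * ((C : ℝ) / n) = C := mul_div_cancel₀ _ hn0r.ne'
  rw [e1, e2, e3, hseg] at hhom
  -- `hhom : q * B = n * ω(1, B/n, C/n)`; monotonicity `(1, t, qt−1) ≤ (1, B/n, C/n)`
  have htB : t ≤ (B : ℝ) / n := by rw [le_div_iff₀ hn0r]; exact hBge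
  have htC : (q : ℝ) * t - 1 ≤ (C : ℝ) / n := by
    rw [le_div_iff₀ hn0r, hCr]
    nlinarith
  have hmono := omegaRect_one_mono₂₃ htB htC
  have hval : omegaRect ℂ 1 ((B : ℝ) / n) ((C : ℝ) / n) = (q : ℝ) * B / n := by
    rw [eq_div_iff hn0r.ne', mul_comm, ← hhom]
  -- `q B / n < q t + q / n ≤ q t + ε`
  have hqn : (q : ℝ) / n < ε := by
    rw [div_lt_iff₀ hn0r]
    have := (div_lt_iff₀ hε).1 hn
    linarith
  have hfin : (q : ℝ) * B / n < (q : ℝ) * t + ε := by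
    have h1 : (q : ℝ) * B / n < ((q : ℝ) * (t * n + 1)) / n :=
      div_lt_div_of_pos_right (mul_lt_mul_of_pos_left hBlt hq0) hn0r
    have h2 : ((q : ℝ) * (t * n + 1)) / n = (q : ℝ) * t + (q : ℝ) / n := by
      field_simp
    linarith
  linarith [hmono, hval]

/-- **`Flat(cw_q) ⟹ α ≥ 2/q`** (the α-point `t = 2/q` of the segment: `ω(1, 2/q, 1) = 2`).  At `q = 2` this is
`α = 1 ⟺ ω = 2`. [cite: VassilevskaWilliamsXuXuZhou2024, §1] -/
theorem alpha_ge_of_littleCwFlat {q : ℕ} (hq : 2 ≤ q) (hflat : asymptoticRank (cwTensor ℂ q) ≤ (q : ℝ) + 1) :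
    2 / (q : ℝ) ≤ dualExponentAlpha ℂ := by
  have hq2 : (2 : ℝ) ≤ q := by exact_mod_cast hq
  have hq0 : (0 : ℝ) < q := by linarith
  have hqm1 : (0 : ℝ) < (q : ℝ) - 1 := by linarith
  have ht1 : 1 / ((q : ℝ) - 1) ≤ 2 / (q : ℝ) := by
    rw [div_le_div_iff₀ hqm1 hq0]
    linarith
  have ht2 : 2 / (q : ℝ) ≤ 1 := by
    rw [div_le_one hq0]
    exact hq2
  have h := omegaRect_thin_eq_of_flat hq hflat ht1 ht2
  have e : (q : ℝ) * (2 / (q : ℝ)) = 2 := by field_simp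
  rw [e, show (2 : ℝ) - 1 = 1 by norm_num] at h
  exact (omegaRect_eq_two_iff_le_dualExponentAlpha ℂ (2 / (q : ℝ))).1 h

/-- **η-graded α-point.**  `R̃(cw_q) ≤ q + 1 + η` (`η ≥ 0`, `q ≥ 2`) gives `ω(1, 2/q, 1) ≤ 2 + 2η/(q log q)`
(the segment point `(q, 2, q)` and homogeneity). -/
theorem omegaRect_alphaPoint_le {q : ℕ} (hq : 2 ≤ q) {η : ℝ} (hη : 0 ≤ η)
    (hr : asymptoticRank (cwTensor ℂ q) ≤ (q : ℝ) + 1 + η) :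
    omegaRect ℂ 1 (2 / (q : ℝ)) 1 ≤ 2 + 2 * η / ((q : ℝ) * Real.log (q : ℝ)) := by
  have hq2 : (2 : ℝ) ≤ q := by exact_mod_cast hq
  have hq0 : (0 : ℝ) < q := by linarith
  have hq1n : 1 ≤ q := by omega
  have h := omegaRect_segment_le_add (q := q) (A := q) (B := 2) (C := q) hq (by norm_num) hq hq
    (by ring) hη hr
  -- homogeneity `ω(q·1, q·(2/q), q·1) = q·ω(1, 2/q, 1)`
  have hhom := omegaRect_smul ℂ hq1n (zero_le_one) (by positivity : (0 : ℝ) ≤ 2 / (q : ℝ)) zero_le_one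
  have e1 : (q : ℝ) * 1 = q := mul_one _
  have e2 : (q : ℝ) * (2 / (q : ℝ)) = 2 := by field_simp
  rw [e1, e2] at hhom
  push_cast at h
  rw [hhom] at h
  -- `h : q · ω(1,2/q,1) ≤ q·2 + 2η/log q`
  have hlogq : 0 < Real.log (q : ℝ) := Real.log_pos (by linarith)
  rw [← sub_nonneg] at h ⊢
  have e3 : 2 + 2 * η / ((q : ℝ) * Real.log (q : ℝ)) - omegaRect ℂ 1 (2 / (q : ℝ)) 1 =
      ((q : ℝ) * 2 + 2 * η / Real.log (q : ℝ) - (q : ℝ) * omegaRect ℂ 1 (2 / (q : ℝ)) 1) / q := by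
    field_simp
  rw [e3]
  positivity

/-- **The `q = 3` instance**: `R̃(cw₃) = 4` gives `E₂` (`ω(1,2,1) = 3`, the conclusion of the route's residual
`TailDescentTwo`/`FiniteSaturation` at `k = 2`), `α ≥ 2/3`, and the thin family `ω(1, t, 3t − 1) = 3t` on
`[1/2, 1]`. -/
theorem flat₃_thin (hflat : asymptoticRank (cwTensor ℂ 3) ≤ 4) :
    omegaRect ℂ 1 2 1 = 3 ∧ 2 / (3 : ℝ) ≤ dualExponentAlpha ℂ ∧
      ∀ t : ℝ, 1 / 2 ≤ t → t ≤ 1 → omegaRect ℂ 1 t (3 * t - 1) = 3 * t := by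
  have hflat' : asymptoticRank (cwTensor ℂ 3) ≤ ((3 : ℕ) : ℝ) + 1 := by norm_num; exact hflat
  refine ⟨?_, ?_, ?_⟩
  · have h := omegaRect_thin_eq_of_flat (q := 3) (by norm_num) hflat' (t := 1) (by norm_num) le_rfl
    norm_num at h
    rw [omegaRect_swap₂₃ ℂ]
    exact h
  · have h := alpha_ge_of_littleCwFlat (q := 3) (by norm_num) hflat'
    exact_mod_cast h
  · intro t ht1 ht2
    have h := omegaRect_thin_eq_of_flat (q := 3) (by norm_num) hflat' (t := t) (by norm_num; linarith) ht2
    exact_mod_cast h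

end Summit.MatrixMultiplication.MatrixMultiplication.Theorems.SaturationLadderLittleCwThin
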